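import Literature.NumberTheory.EllipticCurves.ManinConstantSemistablePrimewise
import Literature.NumberTheory.EllipticCurves.CongruenceNumberCyclicProofs
import Literature.NumberTheory.EllipticCurves.AgasheRibetStein2006.ManinConstantOptimalCurves
import HarnessLib

/-!
# Abbes–Ullmo 1996, Thm. A (`p ∤ N ⇒ p ∤ c`): the printed proof as a reduction to Ribet's
# `deg φ ∣ r` and the degree relation of Prop. 3.3–3.4 (proofs only)

Topic `NumberTheory/EllipticCurves`; namespace `Literature.NumberTheory.EllipticCurves.ModularForms`.
Proofs-only companion (theorems only: no definition, no named fact, nothing restated; D-0026) of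
the named fact `abbesUllmo_not_dvd_maninConstant_of_not_dvd_level`
(`ManinConstantSemistablePrimewise.lean`): A. Abbes, E. Ullmo, *À propos de la conjecture de Manin
pour les courbes elliptiques modulaires*, Compositio Math. 103 (1996) 269–286, **Théorème A**
(p. 269): "Soient `E` une courbe elliptique de Weil forte de conducteur `N` et `p` un nombre premier
ne divisant pas `N`. La constante de Manin `c_E` n'est pas divisible par `p`." — in the tree's
lattice rendering: for every globally minimal `W'/ℚ`, every parametrisation datum `D'` at level
`N'` with `Λ_{E'} ⊆ c Λ_f` (so `c Λ_f = Λ_{E'}`, `φ_{D'}` is the optimal parametrisation of the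
strong Weil curve `E_f ≅ E'` and `c = D'.maninConstant ∈ ℤ` its Manin constant w.r.t. a Néron
differential) and every prime `p ∤ N'`: `p ∤ c`.

HONESTY. Nothing here proves Théorème A, and no summit statement (in particular not
`BirchSwinnertonDyer`) is proved or advanced by this file: it records, as theorems, (1) exactly how
much of the fact is prior art already NAMED in the tree, (2) the architecture of the PRINTED proof
as a reduction to one named fact of the tree plus ONE displayed hypothesis — the part of the
printed argument that needs Néron models and the integral model `M₀(N)` of `X₀(N)`, which the
tree does not have — and (3) the converse bookkeeping showing that this displayed hypothesis is
not stronger than print. The consumer of the fact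
(`SkinnerUrban2014.realPeriodRat_eq_unit_mul_plusPeriod_two_fact_of_abbesUllmo`, bundle
`PublishedInputsHeckeAtTwo`) uses it at `p = 2 ∤ N'` only, which is precisely the part of
Théorème A that is NOT prior art (below).

## The printed proof (op. cit. §1 p. 270, §3 pp. 273–279), and what the tree has of it

* p. 269: "Pour `p > 2`, le Théorème A est contenu dans les travaux de Mazur" — Mazur 1978,
  Cor. 4.1 (`p` odd, `ord_p(N) ≤ 1 ⇒ p ∤ c`) is the tree's sibling named fact
  `mazur_not_dvd_maninConstant_of_odd`; so modulo that fact Théorème A is its own case `p = 2`,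
  `N` odd (`abbesUllmo_not_dvd_maninConstant_of_not_dvd_level_of_mazur_of_two`). Mazur's route
  (exactness of Néron models, Raynaud's `e < p - 1`) does not reach `p = 2` (`e = 1 = p - 1`;
  Prop. 3.1 = Raynaud's Thm. A.1 only gives `v₂(c) ≤ 1`), which is why the paper proceeds
  differently:
* p. 270: "On prouve le théorème A en calculant le degré de la paramétrisation de Weil forte de
  deux manières différentes." With `r` the congruence number (§3 p. 276: "l'entier positif défini
  par … (i) `r = #(S_ℤ(2, Γ₀(N)) / (W(f_E) ∩ S_ℤ(2, Γ₀(N)) ⊕ ℤ f_E))`", `W(f_E)` the Petersson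
  orthogonal of `f_E`; the tree's `congruenceNumber f`, ARS 2012 §2.1 (ii)):
  - **Lemme 3.2 (iii) (Zagier, Ribet)** p. 278: "Le degré de la paramétrisation `deg φ` divise
    `r`." — the tree's named fact `modularDegree_dvd_congruenceNumber` (`CongruenceNumber.lean`,
    ARS 2012 Thm. 2.1, citing [AU96, Lem. 3.2]), stated for data of minimal degree; an optimal
    datum (`c Λ_f = Λ_E`) has minimal degree (`modularDegree_le_of_isogenyMap_ker_eq_bot`,
    `ModularCurveManinSemistableProofs.lean`), so the fact applies to the data of Théorème A.
  - **Proposition 3.3** p. 276: for `p ∤ m` (`m` the largest square dividing `N`),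
    `v_p(deg φ) + v_p(#C) = v_p(r) + v_p(c_E) + v_p(#D)`, where `C`, `D` are the cokernels of
    `I ↪ φ₁^*(S_m)` and `I ↪ H⁰(E_S, Ω¹)`, `I` = image of `H⁰(J₀(N)_S, Ω¹) = H⁰(M₀(N)_S, Ω)` under
    `φ₁^*` (`φ₁ : E → J₀(N)` the dual of the optimal quotient map, extended to Néron models over
    `S = Spec ℤ[1/m]`; proof p. 277: `φ₂ ∘ φ₁ = [deg φ]`, `φ₂^* α_E = c_E f_E`).
  - **Proposition 3.4** p. 277: "tout diviseur premier de `#C` divise `N`" (the `q`-expansion map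
    `H⁰(M₀(N), Ω) ⊗ ℤ_p → B⁰(ℤ_p)` is an isomorphism at `p ∤ N`, §2.1 (2)).
  - **Preuve du Théorème A** p. 279: for `p ∤ N`, `v_p(deg φ) = v_p(r) + v_p(c_E) + v_p(#D)` and
    `deg φ ∣ r` give `v_p(c_E) + v_p(#D) = v_p(deg φ) - v_p(r) ≤ 0`, so `v_p(c_E) = 0`; "il découle
    aussi que `v_p(#D) = 0`", i.e. `v_p(r) = v_p(deg φ)` (ARS 2012 Thm. 2.1, second assertion, at
    `p ∤ N`: the tree's named fact `padicValNat_congruenceNumber_eq_of_not_sq_dvd`).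
  The combination of Prop. 3.3 and Prop. 3.4 USED by that proof is the inequality
  (AU) `v_p(r) + v_p(c_E) ≤ v_p(deg φ)` for `p ∤ N` (drop `v_p(#D) ≥ 0`, use `v_p(#C) = 0`), a
  statement about three integers the tree already names (`congruenceNumber D'.f`,
  `D'.maninConstant`, `D'.modularDegree`) — but whose printed proof needs the Néron models of `E`
  and `J₀(N)` over `ℤ_(p)`, the smooth model `M₀(N)_{ℤ_(p)}` with the `q`-expansion principle, and
  the identification of the analytic parametrisation `φ_{D'}` with a morphism of `ℚ`-curves; none
  of this is in the tree (whose `ModularParametrizationData` is an analytic hypothesis structure).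
  It is therefore DISPLAYED as the hypothesis `hAU` of the reduction
  `abbesUllmo_not_dvd_maninConstant_of_not_dvd_level_of_ribet_of_degreeRelation`, together with the
  finiteness `congruenceNumber D'.f ≠ 0` ("l'entier positif": the tree's `congruenceNumber` is a
  `Nat.card`, `0` on an infinite quotient; the same displayed hypothesis `hr` as in
  `CongruenceNumberProofs.lean`).
* Converse bookkeeping (`degreeRelation_of_abbesUllmo_of_ars`): the displayed inequality follows
  from Théorème A and ARS 2012 Thm. 2.1 (both named facts of the tree), so it asserts nothing
  beyond print; and under Ribet's divisibility it returns both
  (`padicValNat_congruenceNumber_eq_padicValNat_modularDegree_of_degreeRelation`).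
* The displayed inequality in GEOMETRIC (functional) form
  (`ModularParametrizationData.degreeRelation_iff_pullbackIntegral`,
  `abbesUllmo_not_dvd_maninConstant_of_not_dvd_level_of_ribet_of_pullbackIntegral`). By Lemme 3.1
  (p. 275: `φ₁^*` kills `W(f_E)`) and p. 277 (`φ₂ ∘ φ₁ = [deg φ]`, `φ₂^* α_E = c_E f_E`) the pull-back
  `φ₁^* : S₂(Γ₀(N)) = H⁰(J₀(N), Ω¹) → H⁰(E, Ω¹) = ℂ α_E` is `g ↦ (deg φ / c_E) · (⟨f, g⟩/⟨f, f⟩) · α_E`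
  (`⟨f, g⟩/⟨f, f⟩` the coefficient of `f = f_E` in `g`; the tree's Petersson product is linear in
  the second slot), and the content of Prop. 3.3–3.4 at `p ∤ N` is that `φ₁^*` maps
  `H⁰(J₀(N)_{ℤ_(p)}, Ω¹) = S₂(Γ₀(N); ℤ_(p))` (§2.1 (2)) into `H⁰(E_{ℤ_(p)}, Ω¹) = ℤ_(p) α_E` (Néron
  functoriality): **the rational numbers `t_g = deg φ · ⟨f, g⟩ / (c_E ⟨f, f⟩)`, `g ∈ S₂(Γ₀(N); ℤ)`,
  are `p`-integral.** By the cyclicity `⟨f, S₂(Γ₀(N); ℤ)⟩ = (1/r) ℤ ⟨f, f⟩`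
  (`CongruenceNumberCyclicProofs`, = "B est cyclique" in the proof of Lemme 3.2) this is
  EQUIVALENT to `v_p(r) + v_p(c_E) ≤ v_p(deg φ)`; so the reduction is also stated with the
  functional form as its displayed hypothesis — the form a theory of Néron models would deliver.
* What IS settled by computation: for optimal data at level `N' ≤ 130000` no prime divides `c`
  (Agashe–Ribet–Stein 2006 Thm. 2.6, Cremona; tree fact
  `AgasheRibetStein2006.cremona_abs_maninConstant_eq_one_of_level_le`), whence Théorème A at those
  levels (`abbesUllmo_not_dvd_maninConstant_of_level_le_of_cremona`); a finite range, not the fact.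
* Not a route: the tree's elementary finite-height files (`ManinConstantGoodPrimesProofs`,
  `ManinConstantFiniteHeightPrimesProofs`) prove the OPPOSITE inequality `‖c‖_p ≤ 1` (Edixhoven's
  integrality direction) for the same lattice data; the unit direction `p ∤ c` is equivalent to
  the separability of the optimal parametrisation modulo `p` and is invisible to the formal group
  at the cusp (the series `exp_E(Σ aₙ qⁿ/n)` does not see optimality).

## References

* A. Abbes, E. Ullmo, *À propos de la conjecture de Manin pour les courbes elliptiques
  modulaires*, Compositio Math. 103 (1996) 269–286 (numdam `CM_1996__103_3_269_0`): Thm. A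
  (p. 269), §1 (p. 270), Lemme 3.2–3.3, Prop. 3.3, Prop. 3.4, Preuve du Thm. A (pp. 276–279).
  [AbbesUllmo1996]
* B. Mazur, *Rational isogenies of prime degree*, Invent. Math. 44 (1978), Cor. 4.1. [Mazur1978]
* A. Agashe, K. A. Ribet, W. A. Stein, *The modular degree, congruence primes, and multiplicity
  one* (2012), §2.1, Thm. 2.1. [AgasheRibetStein2012]
* A. Agashe, K. Ribet, W. A. Stein, *The Manin constant*, Pure Appl. Math. Q. 2 (2006) 617–636,
  Thm. 2.5 (= [AU96, Thm. A]), Thm. 2.6 (Cremona). [AgasheRibetStein2006]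
-/

noncomputable section

open scoped MatrixGroups ModularForm

open CongruenceSubgroup UpperHalfPlane

namespace Literature.NumberTheory.EllipticCurves.ModularForms

/-! ### Prior art: modulo Mazur's Cor. 4.1, Théorème A is its case `p = 2` -/

/-- **"Pour `p > 2`, le Théorème A est contenu dans les travaux de Mazur"** (Abbes–Ullmo 1996,
p. 269). Modulo the sibling named fact `mazur_not_dvd_maninConstant_of_odd` (Mazur 1978, Cor. 4.1:
`p` odd, `p² ∤ N' ⇒ p ∤ c`; and `p ∤ N' ⇒ p² ∤ N'`), the fact
`abbesUllmo_not_dvd_maninConstant_of_not_dvd_level` reduces to its own case `p = 2`, `N'` odd —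
its new content, and the only case its consumer uses. [cite: AbbesUllmo1996, Thm. A and p. 269]
[cite: Mazur1978, Cor. 4.1] -/
theorem abbesUllmo_not_dvd_maninConstant_of_not_dvd_level_of_mazur_of_two
    (hM : mazur_not_dvd_maninConstant_of_odd)
    (h2 : ∀ (W' : WeierstrassCurve ℚ) [W'.IsElliptic] [W'.IsGloballyMinimal] {N' : ℕ} [NeZero N']
      (D' : ModularParametrizationData W' N'),
      (∀ z ∈ D'.L.lattice, ∃ w ∈ periodLattice D'.f, z = D'.c * w) →
      ¬ 2 ∣ N' → ¬ (2 : ℤ) ∣ D'.maninConstant) :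
    abbesUllmo_not_dvd_maninConstant_of_not_dvd_level := by
  intro W' _ _ N' _ D' hopt p hp hpN
  by_cases hp2 : p = 2
  · subst hp2
    exact h2 W' D' hopt hpN
  · exact hM W' D' hopt p hp hp2 fun h ↦ hpN (dvd_trans (dvd_pow_self p two_ne_zero) h)

/-- Conversely the case `p = 2` is an instance of the fact; so, granted Mazur's Cor. 4.1,
`abbesUllmo_not_dvd_maninConstant_of_not_dvd_level` is EQUIVALENT to its case `p = 2`, `N'` odd.
[cite: AbbesUllmo1996, Thm. A and p. 269] -/
theorem abbesUllmo_not_dvd_maninConstant_of_not_dvd_level_iff_two_of_mazur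
    (hM : mazur_not_dvd_maninConstant_of_odd) :
    abbesUllmo_not_dvd_maninConstant_of_not_dvd_level ↔
      ∀ (W' : WeierstrassCurve ℚ) [W'.IsElliptic] [W'.IsGloballyMinimal] {N' : ℕ} [NeZero N']
        (D' : ModularParametrizationData W' N'),
        (∀ z ∈ D'.L.lattice, ∃ w ∈ periodLattice D'.f, z = D'.c * w) →
        ¬ 2 ∣ N' → ¬ (2 : ℤ) ∣ D'.maninConstant :=
  ⟨fun h W' _ _ _ _ D' hopt h2N ↦ by exact_mod_cast h W' D' hopt 2 Nat.prime_two h2N,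
    abbesUllmo_not_dvd_maninConstant_of_not_dvd_level_of_mazur_of_two hM⟩

/-! ### Arithmetic of the printed proof of Théorème A (p. 279) -/

/-- `a ∣ b ≠ 0 ⇒ v_p(a) ≤ v_p(b)`. [folklore] -/
private theorem padicValNat_le_padicValNat_of_dvd {p a b : ℕ} [Fact p.Prime] (hab : a ∣ b)
    (hb : b ≠ 0) : padicValNat p a ≤ padicValNat p b :=
  (padicValNat_dvd_iff_le hb).mp (dvd_trans pow_padicValNat_dvd hab)

/-- **The last three lines of the printed proof** (Abbes–Ullmo 1996, p. 279: "La Proposition 3.3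
implique que `v_p(deg φ) + v_p(#C) = v_p(r) + v_p(c_E) + v_p(#D)` … `v_p(#C) = 0`. Par le Lemme 3.2,
`deg φ` divise `r`. D'où `v_p(c_E) + v_p(#D) = v_p(deg φ) - v_p(r) ≤ 0`. Ceci montre que
`v_p(c_E) = 0`"), as pure arithmetic on the three integers of a parametrisation datum `D`: if
`deg φ_D ∣ r_f ≠ 0` (`r_f = congruenceNumber D.f`) and `v_p(r_f) + v_p(c) ≤ v_p(deg φ_D)`, then
`p ∤ c` (`c = D.maninConstant ≠ 0`, `maninConstant_ne_zero_holds`). [cite: AbbesUllmo1996, Preuve du Théorème A (p. 279)] -/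
theorem ModularParametrizationData.not_dvd_maninConstant_of_dvd_congruenceNumber_of_le
    {W : WeierstrassCurve ℚ} {N : ℕ} [NeZero N] (D : ModularParametrizationData W N)
    (hdvd : D.modularDegree ∣ congruenceNumber D.f) (hr : congruenceNumber D.f ≠ 0) {p : ℕ}
    (hp : p.Prime)
    (hle : padicValNat p (congruenceNumber D.f) + padicValInt p D.maninConstant ≤
      padicValNat p D.modularDegree) :
    ¬ (p : ℤ) ∣ D.maninConstant := by
  haveI := Fact.mk hp
  intro hpc
  have hc : D.maninConstant ≠ 0 := D.maninConstant_ne_zero_holds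
  -- `deg φ ∣ r ≠ 0` gives `v_p(deg φ) ≤ v_p(r)`
  have h₁ : padicValNat p D.modularDegree ≤ padicValNat p (congruenceNumber D.f) :=
    padicValNat_le_padicValNat_of_dvd hdvd hr
  -- `p ∣ c ≠ 0` gives `1 ≤ v_p(c)`
  have h₂ : 1 ≤ padicValInt p D.maninConstant := by
    rcases (padicValInt_dvd_iff (p := p) 1 D.maninConstant).mp (by rwa [pow_one]) with h | h
    · exact absurd h hc
    · exact h
  omega

/-! ### The reduction: Théorème A from Ribet's `deg φ ∣ r` and the degree relation of Prop. 3.3–3.4 -/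

/-- **Abbes–Ullmo's proof of Théorème A, as a reduction.** The fact
`abbesUllmo_not_dvd_maninConstant_of_not_dvd_level` follows from
(`hR`) the tree's named fact `modularDegree_dvd_congruenceNumber` — Ribet's theorem `deg φ ∣ r`,
which is [AU96, Lemme 3.2 (iii)] (= ARS 2012 Thm. 2.1), applicable because an optimal datum
(`c Λ_f = Λ_{E'}`, `isogenyMap_ker_eq_bot_iff`) has minimal degree among all data with its newform
(`modularDegree_le_of_isogenyMap_ker_eq_bot`) — and
(`hAU`) **the degree relation of [AU96, Prop. 3.3 with Prop. 3.4] at the primes `p ∤ N`**, displayed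
as a hypothesis because its printed proof needs the Néron models of `E'` and `J₀(N')` over `ℤ_(p)`
and the smooth model `M₀(N')_{ℤ_(p)}` with its `q`-expansion principle (not in the tree): for every
globally minimal `W'/ℚ` and every optimal datum `D'` at level `N'`, the congruence number
`r = congruenceNumber D'.f` is a positive integer (§3 p. 276 "l'entier positif `r`"; the tree's
`Nat.card` would be `0` on an infinite quotient) and, for every prime `p ∤ N'`,
`v_p(r) + v_p(c) ≤ v_p(deg φ_{D'})` — Prop. 3.3 (`v_p(deg φ) + v_p(#C) = v_p(r) + v_p(c_E) + v_p(#D)`,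
`p ∤ m`) with Prop. 3.4 (`p ∤ N ⇒ v_p(#C) = 0`) and `v_p(#D) ≥ 0`. The proof is then the printed
one (p. 279), `not_dvd_maninConstant_of_dvd_congruenceNumber_of_le`. Granted `hR`, the hypothesis
`hAU` is implied back by the fact together with ARS 2012 Thm. 2.1
(`degreeRelation_of_abbesUllmo_of_ars`), so it displays nothing stronger than print.
[cite: AbbesUllmo1996, Thm. A; Lemme 3.2 (iii), Prop. 3.3, Prop. 3.4, Preuve du Thm. A (pp. 276–279)]
[cite: AgasheRibetStein2012, Thm. 2.1] -/
theorem abbesUllmo_not_dvd_maninConstant_of_not_dvd_level_of_ribet_of_degreeRelation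
    (hR : modularDegree_dvd_congruenceNumber)
    (hAU : ∀ (W' : WeierstrassCurve ℚ) [W'.IsElliptic] [W'.IsGloballyMinimal] {N' : ℕ} [NeZero N']
      (D' : ModularParametrizationData W' N'),
      (∀ z ∈ D'.L.lattice, ∃ w ∈ periodLattice D'.f, z = D'.c * w) →
      congruenceNumber D'.f ≠ 0 ∧
        ∀ p : ℕ, p.Prime → ¬ p ∣ N' →
          padicValNat p (congruenceNumber D'.f) + padicValInt p D'.maninConstant ≤
            padicValNat p D'.modularDegree) :
    abbesUllmo_not_dvd_maninConstant_of_not_dvd_level := by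
  intro W' _ _ N' _ D' hopt p hp hpN
  obtain ⟨hr, hle⟩ := hAU W' D' hopt
  -- an optimal datum has minimal degree, so Ribet's theorem applies to it
  have hker : D'.isogenyMap.ker = ⊥ := D'.isogenyMap_ker_eq_bot_iff.mpr hopt
  have hdvd : D'.modularDegree ∣ congruenceNumber D'.f :=
    hR W' N' D' fun W'' _ D'' hf ↦ D'.modularDegree_le_of_isogenyMap_ker_eq_bot hker D'' hf
  exact D'.not_dvd_maninConstant_of_dvd_congruenceNumber_of_le hdvd hr hp (hle p hp hpN)

/-- **"Il découle aussi que `v_p(#D) = 0`"** (Abbes–Ullmo 1996, p. 279; = ARS 2012 Thm. 2.1,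
second assertion, at the primes `p ∤ N`): under the same two inputs, `v_p(r) = v_p(deg φ)` for
every optimal datum of a globally minimal model and every prime `p ∤ N'` — the displayed degree
relation gives `≤`, Ribet's divisibility gives `≥`. [cite: AbbesUllmo1996, Preuve du Théorème A (p. 279)]
[cite: AgasheRibetStein2012, Thm. 2.1] -/
theorem padicValNat_congruenceNumber_eq_padicValNat_modularDegree_of_degreeRelation
    (hR : modularDegree_dvd_congruenceNumber)
    (hAU : ∀ (W' : WeierstrassCurve ℚ) [W'.IsElliptic] [W'.IsGloballyMinimal] {N' : ℕ} [NeZero N']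
      (D' : ModularParametrizationData W' N'),
      (∀ z ∈ D'.L.lattice, ∃ w ∈ periodLattice D'.f, z = D'.c * w) →
      congruenceNumber D'.f ≠ 0 ∧
        ∀ p : ℕ, p.Prime → ¬ p ∣ N' →
          padicValNat p (congruenceNumber D'.f) + padicValInt p D'.maninConstant ≤
            padicValNat p D'.modularDegree)
    (W' : WeierstrassCurve ℚ) [W'.IsElliptic] [W'.IsGloballyMinimal] {N' : ℕ} [NeZero N']
    (D' : ModularParametrizationData W' N')
    (hopt : ∀ z ∈ D'.L.lattice, ∃ w ∈ periodLattice D'.f, z = D'.c * w)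
    {p : ℕ} (hp : p.Prime) (hpN : ¬ p ∣ N') :
    padicValNat p (congruenceNumber D'.f) = padicValNat p D'.modularDegree := by
  haveI := Fact.mk hp
  obtain ⟨hr, hle⟩ := hAU W' D' hopt
  have hker : D'.isogenyMap.ker = ⊥ := D'.isogenyMap_ker_eq_bot_iff.mpr hopt
  have hdvd : D'.modularDegree ∣ congruenceNumber D'.f :=
    hR W' N' D' fun W'' _ D'' hf ↦ D'.modularDegree_le_of_isogenyMap_ker_eq_bot hker D'' hf
  have h₁ : padicValNat p D'.modularDegree ≤ padicValNat p (congruenceNumber D'.f) :=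
    padicValNat_le_padicValNat_of_dvd hdvd hr
  have h₂ := hle p hp hpN
  omega

/-! ### Converse bookkeeping: the displayed degree relation asserts nothing beyond print -/

/-- **The degree relation of Prop. 3.3–3.4 (as displayed) follows from Théorème A and ARS 2012
Thm. 2.1** — both named facts of the tree: for an optimal datum `D'` of a globally minimal `W'` and
a prime `p ∤ N'`, `v_p(c) = 0` (`abbesUllmo_not_dvd_maninConstant_of_not_dvd_level`) and
`v_p(r) = v_p(deg φ)` (`padicValNat_congruenceNumber_eq_of_not_sq_dvd` at `p² ∤ N'`, applicable
since optimal data have minimal degree), whence `v_p(r) + v_p(c) ≤ v_p(deg φ)`. So the hypothesis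
`hAU` of `abbesUllmo_not_dvd_maninConstant_of_not_dvd_level_of_ribet_of_degreeRelation` (apart
from the finiteness conjunct `r ≠ 0`, the tree-wide displayed hypothesis `hr`) is, over the tree's
named facts, a CONSEQUENCE of print, not a strengthening of the target.
[cite: AbbesUllmo1996, Thm. A and Preuve (p. 279)] [cite: AgasheRibetStein2012, Thm. 2.1] -/
theorem degreeRelation_of_abbesUllmo_of_ars
    (hA : abbesUllmo_not_dvd_maninConstant_of_not_dvd_level)
    (hB : padicValNat_congruenceNumber_eq_of_not_sq_dvd)
    (W' : WeierstrassCurve ℚ) [W'.IsElliptic] [W'.IsGloballyMinimal] {N' : ℕ} [NeZero N']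
    (D' : ModularParametrizationData W' N')
    (hopt : ∀ z ∈ D'.L.lattice, ∃ w ∈ periodLattice D'.f, z = D'.c * w)
    {p : ℕ} (hp : p.Prime) (hpN : ¬ p ∣ N') :
    padicValNat p (congruenceNumber D'.f) + padicValInt p D'.maninConstant ≤
      padicValNat p D'.modularDegree := by
  haveI := Fact.mk hp
  have hc : padicValInt p D'.maninConstant = 0 :=
    padicValInt.eq_zero_of_not_dvd (hA W' D' hopt p hp hpN)
  have hker : D'.isogenyMap.ker = ⊥ := D'.isogenyMap_ker_eq_bot_iff.mpr hopt
  have hsq : ¬ p ^ 2 ∣ N' := fun h ↦ hpN (dvd_trans (dvd_pow_self p two_ne_zero) h)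
  have hrd : padicValNat p (congruenceNumber D'.f) = padicValNat p D'.modularDegree :=
    hB W' N' D' (fun W'' _ D'' hf ↦ D'.modularDegree_le_of_isogenyMap_ker_eq_bot hker D'' hf) p hp
      hsq
  omega

/-! ### What computation settles: the levels `N' ≤ 130000` (Cremona) -/

/-- **Théorème A at the levels `N' ≤ 130000`, from Cremona's verification `c = 1`**
(Agashe–Ribet–Stein 2006, Thm. 2.6: "If `E` is an optimal elliptic curve over `ℚ` with conductor at
most `130000`, then `c_E = 1`"; tree fact `AgasheRibetStein2006.cremona_abs_maninConstant_eq_one_of_level_le`,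
same lattice rendering): for optimal data at level `N' ≤ 130000` no prime at all divides `c`, in
particular none with `p ∤ N'`. A finite range of levels; the fact itself (all `N'`) is not a
computation. [cite: AgasheRibetStein2006, Thm. 2.5 and Thm. 2.6] -/
theorem abbesUllmo_not_dvd_maninConstant_of_level_le_of_cremona
    (hC : AgasheRibetStein2006.cremona_abs_maninConstant_eq_one_of_level_le)
    (W' : WeierstrassCurve ℚ) [W'.IsElliptic] [W'.IsGloballyMinimal] {N' : ℕ} [NeZero N']
    (D' : ModularParametrizationData W' N')
    (hopt : ∀ z ∈ D'.L.lattice, ∃ w ∈ periodLattice D'.f, z = D'.c * w) (hN : N' ≤ 130000)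
    {p : ℕ} (hp : p.Prime) : ¬ (p : ℤ) ∣ D'.maninConstant :=
  AgasheRibetStein2006.not_dvd_maninConstant_of_level_le hC W' D' hopt hN hp

/-! ### The degree relation in functional form: `p`-integrality of the pull-back `φ₁^*` -/

/-- **Prop. 3.3–3.4 at `p ∤ N`, functional form ⟺ valuation form.** For a parametrisation datum
`D` with `r = congruenceNumber D.f ≠ 0` and a prime `p`, the following are equivalent:
(valuation form) `v_p(r) + v_p(c) ≤ v_p(deg φ_D)`; (functional form) for every
`g ∈ S₂(Γ₀(N); ℤ)` the rational number `t_g` with `deg φ_D · ⟨f, g⟩ = t_g · c · ⟨f, f⟩` is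
`p`-integral (`0 ≤ v_p(t_g)`). Here `g ↦ t_g α_E` is the pull-back
`φ₁^* : H⁰(J₀(N), Ω¹) → H⁰(E, Ω¹)` of Abbes–Ullmo §3 written in the basis `α_E` (Lemme 3.1:
`φ₁^*` kills `W(f_E)`; p. 277: `φ₂ ∘ φ₁ = [deg φ]`, `φ₂^* α_E = c_E f_E`, so
`φ₁^* f_E = (deg φ/c_E) α_E`), and the functional form is the statement
`φ₁^*(S₂(Γ₀(N); ℤ_(p))) ⊆ ℤ_(p) α_E`, i.e. `I_(p) ⊆ H⁰(E_{ℤ_(p)}, Ω¹)` with `C_(p) = 0` (Prop. 3.4).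
Proof: `⟨f, S₂(ℤ)⟩ = (1/r) ℤ ⟨f, f⟩` exactly (`exists_int_congruenceNumber_mul_peterssonProduct_eq`,
`exists_congruenceNumber_mul_peterssonProduct_eq_self` — the cyclicity "`B` est cyclique" of the
proof of Lemme 3.2), so the `t_g` are exactly the integer multiples of `deg φ_D/(r c)`.
[cite: AbbesUllmo1996, Lemme 3.1, Prop. 3.3, Prop. 3.4 (pp. 275–277)] -/
theorem ModularParametrizationData.degreeRelation_iff_pullbackIntegral
    {W : WeierstrassCurve ℚ} {N : ℕ} [NeZero N] (D : ModularParametrizationData W N)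
    (hr : congruenceNumber D.f ≠ 0) {p : ℕ} (hp : p.Prime) :
    padicValNat p (congruenceNumber D.f) + padicValInt p D.maninConstant ≤
        padicValNat p D.modularDegree ↔
      ∀ g ∈ integralCuspForms0 N 2, ∃ t : ℚ, 0 ≤ padicValRat p t ∧
        (D.modularDegree : ℂ) * peterssonProduct (Gamma0 N) 2 D.f g =
          (t : ℂ) * (D.maninConstant : ℂ) * peterssonProduct (Gamma0 N) 2 D.f D.f := by
  haveI := Fact.mk hp
  have hc : D.maninConstant ≠ 0 := D.maninConstant_ne_zero_holds
  have hdeg : D.modularDegree ≠ 0 := D.deg_pos.ne'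
  have hf0 : D.f ≠ 0 := D.isNewformOf.1.ne_zero
  have hω0 : peterssonProduct (Gamma0 N) 2 D.f D.f ≠ 0 := by
    intro h0
    have hpos := peterssonProduct_self_pos_holds (Gamma0 N : Subgroup (GL (Fin 2) ℝ)) 2 hf0
    rw [h0, Complex.zero_re] at hpos
    exact lt_irrefl _ hpos
  -- the cyclicity inputs, before generalising `r`
  have hcyc := exists_congruenceNumber_mul_peterssonProduct_eq_self D.f_mem_integralCuspForms0 hf0 hr
  have hmul : ∀ g ∈ integralCuspForms0 N 2, ∃ n : ℤ,
      (congruenceNumber D.f : ℂ) * peterssonProduct (Gamma0 N) 2 D.f g =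
        n * peterssonProduct (Gamma0 N) 2 D.f D.f := fun g hg ↦
    exists_int_congruenceNumber_mul_peterssonProduct_eq D.f hg
  generalize congruenceNumber D.f = r at hr hcyc hmul ⊢
  generalize D.modularDegree = d at hdeg ⊢
  generalize D.maninConstant = c at hc ⊢
  have hrQ : (r : ℚ) ≠ 0 := by exact_mod_cast hr
  have hcQ : (c : ℚ) ≠ 0 := by exact_mod_cast hc
  have hdQ : (d : ℚ) ≠ 0 := by exact_mod_cast hdeg
  -- `v_p` of the rational number `d/(r c)`
  have hval : padicValRat p ((d : ℚ) / ((r : ℚ) * (c : ℚ))) =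
      (padicValNat p d : ℤ) - ((padicValNat p r : ℤ) + (padicValInt p c : ℤ)) := by
    rw [padicValRat.div hdQ (mul_ne_zero hrQ hcQ), padicValRat.mul hrQ hcQ, padicValRat.of_nat,
      padicValRat.of_nat, padicValRat.of_int]
  constructor
  · -- valuation form ⇒ functional form: `t_g = n(g) · d/(r c)`
    intro hle g hg
    obtain ⟨n, hn⟩ := hmul g hg
    refine ⟨(n : ℚ) * ((d : ℚ) / ((r : ℚ) * (c : ℚ))), ?_, ?_⟩
    · rcases eq_or_ne n 0 with rfl | hn0
      · rw [Int.cast_zero, zero_mul, padicValRat.zero]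
      · rw [padicValRat.mul (Int.cast_ne_zero.mpr hn0) (div_ne_zero hdQ (mul_ne_zero hrQ hcQ)),
          hval, padicValRat.of_int]
        have h0 : (0 : ℤ) ≤ padicValInt p n := by exact_mod_cast Nat.zero_le _
        omega
    · -- `d ⟨f, g⟩ = (n d/(r c)) c ⟨f, f⟩` since `r ⟨f, g⟩ = n ⟨f, f⟩`
      have hrC : (r : ℂ) ≠ 0 := by exact_mod_cast hr
      have hcC : (c : ℂ) ≠ 0 := by exact_mod_cast hc
      have e : peterssonProduct (Gamma0 N) 2 D.f g =
          (n : ℂ) * peterssonProduct (Gamma0 N) 2 D.f D.f / (r : ℂ) := by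
        rw [eq_div_iff hrC, mul_comm, hn]
      rw [e]
      push_cast
      field_simp
  · -- functional form ⇒ valuation form: test on `g₀` with `r ⟨f, g₀⟩ = ⟨f, f⟩`
    intro hfun
    obtain ⟨g₀, hg₀, hPg₀⟩ := hcyc
    obtain ⟨t, ht, hte⟩ := hfun g₀ hg₀
    -- `d = r t c`
    have hdt : (d : ℚ) = (r : ℚ) * t * (c : ℚ) := by
      have hrC : (r : ℂ) ≠ 0 := by exact_mod_cast hr
      have e : peterssonProduct (Gamma0 N) 2 D.f g₀ =
          peterssonProduct (Gamma0 N) 2 D.f D.f / (r : ℂ) := by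
        rw [eq_div_iff hrC, mul_comm, hPg₀]
      rw [e, mul_div_assoc', div_eq_iff hrC] at hte
      -- `hte : d ⟨f,f⟩ = t c ⟨f,f⟩ r`
      have e3 : (d : ℂ) = (r : ℂ) * (t : ℂ) * (c : ℂ) :=
        mul_right_cancel₀ hω0
          (show (d : ℂ) * peterssonProduct (Gamma0 N) 2 D.f D.f =
            ((r : ℂ) * (t : ℂ) * (c : ℂ)) * peterssonProduct (Gamma0 N) 2 D.f D.f by
            rw [hte]; ring)
      have e2 : ((d : ℚ) : ℂ) = (((r : ℚ) * t * (c : ℚ) : ℚ) : ℂ) := by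
        push_cast
        exact e3
      exact_mod_cast e2
    have ht0 : t ≠ 0 := by
      rintro rfl
      rw [mul_zero, zero_mul] at hdt
      exact hdQ hdt
    have htval : padicValRat p t = (padicValNat p d : ℤ) - ((padicValNat p r : ℤ) + (padicValInt p c : ℤ)) := by
      rw [← hval, hdt, mul_assoc, mul_comm (r : ℚ), mul_assoc, mul_div_assoc,
        mul_comm (c : ℚ) (r : ℚ), div_self (mul_ne_zero hrQ hcQ), mul_one]
    rw [htval] at ht
    omega

/-- **Abbes–Ullmo's proof of Théorème A as a reduction, with the geometric input displayed in
functional form.** The fact `abbesUllmo_not_dvd_maninConstant_of_not_dvd_level` follows from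
(`hR`) Ribet's `deg φ ∣ r` (tree fact `modularDegree_dvd_congruenceNumber`, = Lemme 3.2 (iii)) and
(`hI`) for every globally minimal `W'`, every optimal datum `D'` at level `N'` and every prime
`p ∤ N'`: `r = congruenceNumber D'.f` is a positive integer and **the pull-back
`φ₁^* = (deg φ/c) · ⟨f, ·⟩/⟨f, f⟩ · α_E` maps `S₂(Γ₀(N'); ℤ)` into `ℤ_(p) α_E`** (the numbers
`deg φ · ⟨f, g⟩/(c ⟨f, f⟩)`, `g ∈ S₂(ℤ)`, are `p`-integral) — Prop. 3.3 with Prop. 3.4 at `p ∤ N`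
(`I_(p) = φ₁^*(S₂(ℤ_(p))) ⊆ H⁰(E_{ℤ_(p)}, Ω¹)`, Néron functoriality and the `q`-expansion
isomorphism §2.1 (2)), whose proof needs the Néron models of `E'`, `J₀(N')` and the model
`M₀(N')_{ℤ_(p)}` (not in the tree). Via `degreeRelation_iff_pullbackIntegral` and
`abbesUllmo_not_dvd_maninConstant_of_not_dvd_level_of_ribet_of_degreeRelation`.
[cite: AbbesUllmo1996, Thm. A; Lemme 3.1–3.2, Prop. 3.3, Prop. 3.4, Preuve du Thm. A (pp. 275–279)]
[cite: AgasheRibetStein2012, Thm. 2.1] -/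
theorem abbesUllmo_not_dvd_maninConstant_of_not_dvd_level_of_ribet_of_pullbackIntegral
    (hR : modularDegree_dvd_congruenceNumber)
    (hI : ∀ (W' : WeierstrassCurve ℚ) [W'.IsElliptic] [W'.IsGloballyMinimal] {N' : ℕ} [NeZero N']
      (D' : ModularParametrizationData W' N'),
      (∀ z ∈ D'.L.lattice, ∃ w ∈ periodLattice D'.f, z = D'.c * w) →
      congruenceNumber D'.f ≠ 0 ∧
        ∀ p : ℕ, p.Prime → ¬ p ∣ N' →
          ∀ g ∈ integralCuspForms0 N' 2, ∃ t : ℚ, 0 ≤ padicValRat p t ∧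
            (D'.modularDegree : ℂ) * peterssonProduct (Gamma0 N') 2 D'.f g =
              (t : ℂ) * (D'.maninConstant : ℂ) * peterssonProduct (Gamma0 N') 2 D'.f D'.f) :
    abbesUllmo_not_dvd_maninConstant_of_not_dvd_level := by
  refine abbesUllmo_not_dvd_maninConstant_of_not_dvd_level_of_ribet_of_degreeRelation hR
    fun W' _ _ N' _ D' hopt ↦ ?_
  obtain ⟨hr, hfun⟩ := hI W' D' hopt
  exact ⟨hr, fun p hp hpN ↦ (D'.degreeRelation_iff_pullbackIntegral hr hp).mpr (hfun p hp hpN)⟩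

end Literature.NumberTheory.EllipticCurves.ModularForms

end
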